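import Literature.Computability.Complexity.IKWSimulationMachine
import Literature.Computability.Complexity.ClockedUniversalSimulationProofs
import Literature.Computability.Complexity.PlumbingBricks
import Literature.Computability.Complexity.TimeConstructibleClosure
import Literature.Computability.Complexity.MurrayWilliams2018Simulation
import Literature.Computability.Complexity.PaddedBodyVerifier
import Literature.Computability.Complexity.MurrayWilliams2018Lemma41Assembly
import HarnessLib

/-!
# Murray–Williams 2018, Lemma 4.1 (proof): the simulation `N` as ONE polynomial-time body

The running time of the derandomized simulation `N` of Murray–Williams 2018 (ECCC TR17-188,
p. 14; behaviour `MWSim.verdictBit`, language `MWSim.simLang`, `MurrayWilliams2018Simulation.lean`)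
is the hypothesis `hN` of the conditional Lemma 4.1
(`MWSim.MurrayWilliams2018_lemma_4_1_ae_of_thm_3_1_of_thm_2_1_of_sim`,
`MurrayWilliams2018Lemma41Assembly.lean`): `simLang ∈ NTIME (t · ^ E)` with `E` fixed before the
referee, the verifier and the time bound are known. By the packaging
`PadVerif.exists_exponent` (`PaddedBodyVerifier.lean`) it suffices to write `N` as ONE `FP` body
`MWSim.Mach.body γ K F`, depending only on the seed constant `γ`, the exponent `K` of the output
length and the generator `F`, which receives everything instance-specific as a DATA prefix
`D = ⟨e_t, ⟨e_mv, ⟨e_V, ⟨e_R, ⟨1^{c_V}, 1^{C_Nb}⟩⟩⟩⟩⟩` — codes, for the tree's clocked universal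
interpreter (`ClockedUS.Ufn`/`ClockedUS.run`, `ClockedUniversalSimulationProofs.lean`; Arora–Barak
Thm. 1.9), of the constructors of `t` and `mv`, of the verifier's machine and of Arthur's
predicate, and the two constants in unary — and the pad `P = 1^{T_A |w|}` as the universal budget
and ruler. This file DEFINES that body from the tree's `FP` bricks (the pattern of
`IKWSimulationMachine.lean`, Stage 4 of which — the counted fold over all seeds — is reused
verbatim in shape), proves it is in `FP` and answers one bit on every input, and computes its
VALUE on well-formed inputs with an adequate pad: `MWSim.Mach.body_apply` — it is
`[MWSim.verdictBit …]`, given the universal interpreter's answers for the four coded machines.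

Values in unary of the coded constructors are read through `ClockedUS.Ufn` and measured on the
ruler `P` (`binToUnaryFn`); any `some` answer of `ClockedUS.run` is the true output
(`ClockedUS.run_eq_of_outputsWithin`: monotonicity in the budget plus completeness). The main
results: `MWSim.Mach.simLang_mem_NTIME` — hypothesis `hN` of the conditional Lemma 4.1,
discharged — and `MWSim.Mach.MurrayWilliams2018_lemma_4_1_ae_of_thm_3_1_of_thm_2_1`: the named
fact `MurrayWilliams2018_lemma_4_1_ae` from Thm. 3.1 (`h31`) and Umans' Thm. 2.1 (`h21`) ALONE.

Relation to `MurrayWilliams2018SimulationMachine.lean` (`MWSimN.*`, the machine of the parallel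
assembly `MurrayWilliams2018_lemma_4_1_ae_of_ingredients`): that file builds a DEDICATED machine
for its own behaviour `MWSimN.verdictBit` (clocks of `m` and `c_V t + c_V` under `mapFstAux`, the
verifier run directly, a `Ref`-specific `FP` verdict), its exponent being fixed after the referee
`Ref ∈ P` (which its `h31` fixes once and for all); here the referee may depend on `s`, so the
exponent must not depend on it, whence ONE universal body reading all machines as coded data
through the clocked universal interpreter. Definitions with bodies and theorems only; no named
fact.

## References

* C. D. Murray, R. R. Williams, *Circuit lower bounds for nondeterministic quasi-polytime: an easy
  witness lemma for NP and NQP*, STOC 2018 (ECCC TR17-188), proof of Lemma 4.1, p. 14 (the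
  algorithm `N` and its running time) [MurrayWilliams2018].
* S. Arora, B. Barak, *Computational Complexity: A Modern Approach*, CUP 2009, Thm. 1.9 and §1.4.1
  (universal machine with a time bound), proof of Lemma 20.3 (enumerating seeds) [AroraBarakCC2009].
* R. Impagliazzo, V. Kabanets, A. Wigderson, *In search of an easy witness*, JCSS 65 (2002),
  Thm. 12 (the simulation pattern) [ImpagliazzoKabanetsWigderson2002].
-/

noncomputable section

namespace Literature.Computability.Complexity

open _root_.Computability Turing Finset Filter Polynomial Brick Plumb

/-! ### The universal interpreter: any answer is the true output -/

namespace ClockedUS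

/-- **Any answer of the clocked interpreter is the machine's output.** If `M` outputs `y` on `w`
within `s` steps and `run ⟨ecode M, w⟩ B = some y'` for some budget `B`, then `y' = y` (both
persist to the budget `max B (haltAddr · s)`, `run_mono`, where completeness `sim` gives `y`).
[cite: AroraBarakCC2009, Thm. 1.9 and §1.4.1] -/
theorem run_eq_of_outputsWithin (M : TM2ComputableAux Bool Bool) {w y y' : List Bool} {s B : ℕ}
    (h : M.OutputsWithin w y s) (hr : run (progM M w) B = some y') : y' = y := by
  have h1 := run_mono (le_max_left B ((ClockedUA.pM M).eval s)) hr
  have h2 := run_mono (le_max_right B ((ClockedUA.pM M).eval s)) (sim M h)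
  rw [h1] at h2
  exact Option.some.inj h2

/-- With a budget beyond the overhead, the interpreter answers with the output.
[cite: AroraBarakCC2009, Thm. 1.9 and §1.4.1] -/
theorem run_eq_some (M : TM2ComputableAux Bool Bool) {w y : List Bool} {s B : ℕ}
    (h : M.OutputsWithin w y s) (hB : (ClockedUA.pM M).eval s ≤ B) : run (progM M w) B = some y :=
  run_mono hB (sim M h)

end ClockedUS

namespace MWSim

namespace Mach

/-! ### Plumbing of the body input `Z = ⟨D, ⟨⟨w, P⟩, u'⟩⟩` -/

/-- The data `D`. [folklore] -/
def dF : List Bool → List Bool := fstF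
/-- The input word `w = ⟨x, ⟨x_h, α⟩⟩`. [folklore] -/
def wF : List Bool → List Bool := fstF ∘ fstF ∘ sndF
/-- The pad `P`. [folklore] -/
def pF : List Bool → List Bool := sndF ∘ fstF ∘ sndF
/-- The kept guess `u'`. [folklore] -/
def uF : List Bool → List Bool := sndF ∘ sndF
/-- `x`. [folklore] -/
def xF : List Bool → List Bool := fstF ∘ wF
/-- `x_h`. [folklore] -/
def xhF : List Bool → List Bool := fstF ∘ sndF ∘ wF
/-- `α`. [folklore] -/
def aF : List Bool → List Bool := sndF ∘ sndF ∘ wF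
/-- The code of the constructor of `t`. [folklore] -/
def eTF : List Bool → List Bool := fstF ∘ dF
/-- The code of the constructor of `mv`. [folklore] -/
def eMF : List Bool → List Bool := fstF ∘ sndF ∘ dF
/-- The code of the verifier's machine. [folklore] -/
def eVF : List Bool → List Bool := fstF ∘ sndF ∘ sndF ∘ dF
/-- The code of Arthur's predicate. [folklore] -/
def eRF : List Bool → List Bool := fstF ∘ sndF ∘ sndF ∘ sndF ∘ dF
/-- The constant `1^{c_V}`. [folklore] -/
def cVF : List Bool → List Bool := fstF ∘ sndF ∘ sndF ∘ sndF ∘ sndF ∘ dF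
/-- The constant `1^{C_Nb}`. [folklore] -/
def cNF : List Bool → List Bool := sndF ∘ sndF ∘ sndF ∘ sndF ∘ sndF ∘ dF

/-- **A value in unary through the universal interpreter**: run the code `e Z` on the unary input
`|inp Z|` with budget `|P|`, read the numeral out of the `optionBool` code (its tail) and measure
it on the ruler `P`. [cite: AroraBarakCC2009, Thm. 1.9 and §1.4.1] -/
def uvalF (e inp : List Bool → List Bool) : List Bool → List Bool :=
  binToUnaryFn ∘ fanoutFn pF (List.tail ∘ ClockedUS.Ufn ∘ fanoutFn (fanoutFn e (onesFn ∘ inp)) pF)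

/-- `t |x_h|` in unary. [folklore] -/
def tHF : List Bool → List Bool := uvalF eTF xhF
/-- `t |w|` in unary. [folklore] -/
def tNF : List Bool → List Bool := uvalF eTF wF
/-- `mv |x|` in unary. [folklore] -/
def mvLF : List Bool → List Bool := uvalF eMF xF
/-- `mv |w|` in unary. [folklore] -/
def mvNF : List Bool → List Bool := uvalF eMF wF

/-- Unary product measured on the ruler: `⟨…⟩ ↦ 1^{|a Z| · |b Z|}` (numerals, `prodFn`,
`binToUnaryFn`). [folklore] -/
def mulUF (a b : List Bool → List Bool) : List Bool → List Bool :=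
  binToUnaryFn ∘ fanoutFn pF (prodFn ∘ fanoutFn (lenBinF ∘ a) (lenBinF ∘ b))

/-- The witness bound `1^{c_V t|x_h| + c_V}`. [folklore] -/
def bHF : List Bool → List Bool := fun z => mulUF cVF tHF z ++ cVF z
/-- The bound `1^{c_V t|w| + c_V}`. [folklore] -/
def bNF : List Bool → List Bool := fun z => mulUF cVF tNF z ++ cVF z
/-- The kept length `1^{2 (c_V t|w| + c_V) + mv|w| + 2}`. [folklore] -/
def UF : List Bool → List Bool := fun z => bNF z ++ bNF z ++ mvNF z ++ [true, true]
/-- The guess cut at the kept length. [folklore] -/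
def ucF : List Bool → List Bool := takeFn ∘ fanoutFn UF uF
/-- The witness `y = (fst u_c) ↾ bound`. [folklore] -/
def yF : List Bool → List Bool := takeFn ∘ fanoutFn bHF (fstF ∘ ucF)
/-- `2^M` in unary, `M = |bin bound|`. [folklore] -/
def twoMF : List Bool → List Bool :=
  binToUnaryFn ∘ fanoutFn pF ((fun w => Kannan.zerosFn w ++ [true]) ∘ lenBinF ∘ bHF)
/-- The table: the witness padded by `0`s to `2^M` bits. [folklore] -/
def TF : List Bool → List Bool := fstF ∘ padTakeFn ∘ fanoutFn twoMF yF
/-- Merlin's message `z = takeD (mv |x|) (snd u_c)`. [folklore] -/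
def zF : List Bool → List Bool := fstF ∘ padTakeFn ∘ fanoutFn mvLF (sndF ∘ ucF)
/-- The seed length `1^{γ M}`. [folklore] -/
def kF (γ : ℕ) : List Bool → List Bool := onesMulFn γ ∘ lenBinF ∘ bHF
/-- The base `1^{|x| + |α| + mv|x| + 2}` of the output length. [folklore] -/
def baseF : List Bool → List Bool := fun z => xF z ++ aF z ++ mvLF z ++ [true, true]
/-- The output length `1^{C_Nb · base^{2K+2} + 7}`. [folklore] -/
def nbF (K : ℕ) : List Bool → List Bool :=
  binToUnaryFn ∘ fanoutFn pF (addFn ∘ fanoutFn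
    (prodFn ∘ fanoutFn (lenBinF ∘ cNF) (powNumFn (2 * K + 2) ∘ lenBinF ∘ baseF)) (fun _ => encodeNat 7))
/-- Arthur's board `⟨⟨x, α⟩, z⟩`. [folklore] -/
def boardF : List Bool → List Bool := fanoutFn (fanoutFn xF aF) zF

/-! ### The fold over the seeds (Stage 4 of `IKWSimulationMachine.lean`, with the universal query) -/

/-! The fold record is `X = ⟨P, ⟨A, ⟨T, ⟨1^{nb}, ⟨1^{mv}, ⟨1^{k}, e_R⟩⟩⟩⟩⟩⟩`; the pieces receive
`⟨X, 1ⁱ⟩`. -/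

/-- Field `P` of a piece argument. [folklore] -/
def PZ : List Bool → List Bool := fstF ∘ fstF
/-- Field `A` (the board). [folklore] -/
def AZ : List Bool → List Bool := fstF ∘ sndF ∘ fstF
/-- Field `T` (the table). [folklore] -/
def TZ : List Bool → List Bool := fstF ∘ sndF ∘ sndF ∘ fstF
/-- Field `1^{nb}`. [folklore] -/
def NZ : List Bool → List Bool := fstF ∘ sndF ∘ sndF ∘ sndF ∘ fstF
/-- Field `1^{mv}`. [folklore] -/
def MZ : List Bool → List Bool := fstF ∘ sndF ∘ sndF ∘ sndF ∘ sndF ∘ fstF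
/-- Field `1^{k}`. [folklore] -/
def KZ : List Bool → List Bool := fstF ∘ sndF ∘ sndF ∘ sndF ∘ sndF ∘ sndF ∘ fstF
/-- Field `e_R`. [folklore] -/
def EZ : List Bool → List Bool := sndF ∘ sndF ∘ sndF ∘ sndF ∘ sndF ∘ sndF ∘ fstF
/-- The round index `1ⁱ`. [folklore] -/
def IZ : List Bool → List Bool := sndF

/-- The `i`-th seed `takeD k (bin i)`. [cite: AroraBarakCC2009, Lemma 20.3 (proof)] -/
def seedZ : List Bool → List Bool := fstF ∘ padTakeFn ∘ fanoutFn KZ (lenBinF ∘ IZ)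
/-- The generator's output on the `i`-th seed: `F ⟨T, ⟨1^{nb}, seedᵢ⟩⟩`. [cite: MurrayWilliams2018, Lemma 4.1 (proof)] -/
def outZ (F : List Bool → List Bool) : List Bool → List Bool := F ∘ fanoutFn TZ (fanoutFn NZ seedZ)
/-- Arthur's coins in round `i`: `takeD mv outᵢ`. [folklore] -/
def rZ (F : List Bool → List Bool) : List Bool → List Bool := fstF ∘ padTakeFn ∘ fanoutFn MZ (outZ F)
/-- **The universal query of round `i`**: the `optionBool` code of the interpreter's answer on
`e_R` run on `⟨A, rᵢ⟩` with budget `|P|`. [cite: AroraBarakCC2009, Thm. 1.9 and §1.4.1] -/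
def qZ (F : List Bool → List Bool) : List Bool → List Bool :=
  ClockedUS.Ufn ∘ fanoutFn (fanoutFn EZ (fanoutFn AZ (rZ F))) PZ
/-- **The piece of round `i`**: the bit `[answerᵢ = some [1]]`. [cite: MurrayWilliams2018, Lemma 4.1 (proof)] -/
def pieceZ (F : List Bool → List Bool) : List Bool → List Bool :=
  eqPairFn ∘ fanoutFn (qZ F) (fun _ => [true, true])

/-- Field `1^{k}` of the record. [folklore] -/
def KX : List Bool → List Bool := fstF ∘ sndF ∘ sndF ∘ sndF ∘ sndF ∘ sndF
/-- The number of seeds as a numeral `0^k 1`. [folklore] -/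
def cntNumX : List Bool → List Bool := (fun w => Kannan.zerosFn w ++ [true]) ∘ KX
/-- The fold's initial state `⟨X, ⟨bin 2^k, ⟨1⁰, bin 0⟩⟩⟩`. [folklore] -/
def initX : List Bool → List Bool := fanoutFn (fun w => w) (fanoutFn cntNumX fun _ => boolPair [] [])
/-- **The number of accepting seeds** as a numeral (counted fold, capacity `|X|`).
[cite: AroraBarakCC2009, Lemma 20.3 (proof)] -/
def accX (F : List Bool → List Bool) : List Bool → List Bool :=
  sndPow 2 ∘ foldLoop addFn (clipF 1 (pieceZ F)) X ∘ initX
/-- **The verdict on a record**: `[2^k < 2 · #accepting seeds]`. [cite: AroraBarakCC2009, Lemma 20.3 (proof)] -/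
def verdictX (F : List Bool → List Bool) : List Bool → List Bool :=
  ltFn ∘ fanoutFn cntNumX (addFn ∘ fanoutFn (accX F) (accX F))

/-! ### The body -/

/-- The fold record made from the body input. [folklore] -/
def mkX (γ K : ℕ) : List Bool → List Bool :=
  fanoutFn pF (fanoutFn boardF (fanoutFn TF (fanoutFn (nbF K) (fanoutFn mvLF (fanoutFn (kF γ) eRF)))))
/-- **The verifier's bit**: `[answer of e_V on ⟨x_h, y⟩ = some [1]]`. [cite: MurrayWilliams2018, Lemma 4.1 (proof)] -/
def vbitF : List Bool → List Bool :=
  eqPairFn ∘ fanoutFn (ClockedUS.Ufn ∘ fanoutFn (fanoutFn eVF (fanoutFn xhF yF)) pF) (fun _ => [true, true])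
/-- **The body of `N`**: the verifier's bit AND the majority verdict.
[cite: MurrayWilliams2018, Lemma 4.1 (proof)] -/
def body (γ K : ℕ) (F : List Bool → List Bool) : List Bool → List Bool :=
  andFn vbitF (verdictX F ∘ mkX γ K)

/-! ### Membership in `FP` -/

section FP

variable {F : List Bool → List Bool}

/-- Membership in `FP` (`dF_mem_FP`). [folklore] -/
theorem dF_mem_FP : dF ∈ FP := fstF_mem_FP
/-- Membership in `FP` (`wF_mem_FP`). [folklore] -/
theorem wF_mem_FP : wF ∈ FP := comp_mem_FP fstF_mem_FP (comp_mem_FP fstF_mem_FP sndF_mem_FP)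
/-- Membership in `FP` (`pF_mem_FP`). [folklore] -/
theorem pF_mem_FP : pF ∈ FP := comp_mem_FP sndF_mem_FP (comp_mem_FP fstF_mem_FP sndF_mem_FP)
/-- Membership in `FP` (`uF_mem_FP`). [folklore] -/
theorem uF_mem_FP : uF ∈ FP := comp_mem_FP sndF_mem_FP sndF_mem_FP
/-- Membership in `FP` (`xF_mem_FP`). [folklore] -/
theorem xF_mem_FP : xF ∈ FP := comp_mem_FP fstF_mem_FP wF_mem_FP
/-- Membership in `FP` (`xhF_mem_FP`). [folklore] -/
theorem xhF_mem_FP : xhF ∈ FP := comp_mem_FP fstF_mem_FP (comp_mem_FP sndF_mem_FP wF_mem_FP)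
/-- Membership in `FP` (`aF_mem_FP`). [folklore] -/
theorem aF_mem_FP : aF ∈ FP := comp_mem_FP sndF_mem_FP (comp_mem_FP sndF_mem_FP wF_mem_FP)
/-- Membership in `FP` (`eTF_mem_FP`). [folklore] -/
theorem eTF_mem_FP : eTF ∈ FP := comp_mem_FP fstF_mem_FP dF_mem_FP
/-- Membership in `FP` (`eMF_mem_FP`). [folklore] -/
theorem eMF_mem_FP : eMF ∈ FP := comp_mem_FP fstF_mem_FP (comp_mem_FP sndF_mem_FP dF_mem_FP)
/-- Membership in `FP` (`eVF_mem_FP`). [folklore] -/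
theorem eVF_mem_FP : eVF ∈ FP :=
  comp_mem_FP fstF_mem_FP (comp_mem_FP sndF_mem_FP (comp_mem_FP sndF_mem_FP dF_mem_FP))
/-- Membership in `FP` (`eRF_mem_FP`). [folklore] -/
theorem eRF_mem_FP : eRF ∈ FP :=
  comp_mem_FP fstF_mem_FP (comp_mem_FP sndF_mem_FP (comp_mem_FP sndF_mem_FP (comp_mem_FP sndF_mem_FP dF_mem_FP)))
/-- Membership in `FP` (`cVF_mem_FP`). [folklore] -/
theorem cVF_mem_FP : cVF ∈ FP :=
  comp_mem_FP fstF_mem_FP (comp_mem_FP sndF_mem_FP (comp_mem_FP sndF_mem_FP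
    (comp_mem_FP sndF_mem_FP (comp_mem_FP sndF_mem_FP dF_mem_FP))))
/-- Membership in `FP` (`cNF_mem_FP`). [folklore] -/
theorem cNF_mem_FP : cNF ∈ FP :=
  comp_mem_FP sndF_mem_FP (comp_mem_FP sndF_mem_FP (comp_mem_FP sndF_mem_FP
    (comp_mem_FP sndF_mem_FP (comp_mem_FP sndF_mem_FP dF_mem_FP))))

/-- Membership in `FP` (`uvalF_mem_FP`). [folklore] -/
theorem uvalF_mem_FP {e inp : List Bool → List Bool} (he : e ∈ FP) (hi : inp ∈ FP) : uvalF e inp ∈ FP :=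
  comp_mem_FP binToUnaryFn_mem_FP (fanoutFn_mem_FP pF_mem_FP
    (comp_mem_FP PRelSigma.tail_mem_FP (comp_mem_FP ClockedUS.Ufn_mem_FP
      (fanoutFn_mem_FP (fanoutFn_mem_FP he (comp_mem_FP onesFn_mem_FP hi)) pF_mem_FP))))
/-- Membership in `FP` (`tHF_mem_FP`). [folklore] -/
theorem tHF_mem_FP : tHF ∈ FP := uvalF_mem_FP eTF_mem_FP xhF_mem_FP
/-- Membership in `FP` (`tNF_mem_FP`). [folklore] -/
theorem tNF_mem_FP : tNF ∈ FP := uvalF_mem_FP eTF_mem_FP wF_mem_FP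
/-- Membership in `FP` (`mvLF_mem_FP`). [folklore] -/
theorem mvLF_mem_FP : mvLF ∈ FP := uvalF_mem_FP eMF_mem_FP xF_mem_FP
/-- Membership in `FP` (`mvNF_mem_FP`). [folklore] -/
theorem mvNF_mem_FP : mvNF ∈ FP := uvalF_mem_FP eMF_mem_FP wF_mem_FP
/-- Membership in `FP` (`mulUF_mem_FP`). [folklore] -/
theorem mulUF_mem_FP {a b : List Bool → List Bool} (ha : a ∈ FP) (hb : b ∈ FP) : mulUF a b ∈ FP :=
  comp_mem_FP binToUnaryFn_mem_FP (fanoutFn_mem_FP pF_mem_FP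
    (comp_mem_FP prodFn_mem_FP (fanoutFn_mem_FP (comp_mem_FP lenBinF_mem_FP ha) (comp_mem_FP lenBinF_mem_FP hb))))
/-- Membership in `FP` (`bHF_mem_FP`). [folklore] -/
theorem bHF_mem_FP : bHF ∈ FP := append_mem_FP (mulUF_mem_FP cVF_mem_FP tHF_mem_FP) cVF_mem_FP
/-- Membership in `FP` (`bNF_mem_FP`). [folklore] -/
theorem bNF_mem_FP : bNF ∈ FP := append_mem_FP (mulUF_mem_FP cVF_mem_FP tNF_mem_FP) cVF_mem_FP
/-- Membership in `FP` (`UF_mem_FP`). [folklore] -/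
theorem UF_mem_FP : UF ∈ FP :=
  append_mem_FP (append_mem_FP (append_mem_FP bNF_mem_FP bNF_mem_FP) mvNF_mem_FP) (const_mem_FP _)
/-- Membership in `FP` (`ucF_mem_FP`). [folklore] -/
theorem ucF_mem_FP : ucF ∈ FP := comp_mem_FP takeFn_mem_FP (fanoutFn_mem_FP UF_mem_FP uF_mem_FP)
/-- Membership in `FP` (`yF_mem_FP`). [folklore] -/
theorem yF_mem_FP : yF ∈ FP :=
  comp_mem_FP takeFn_mem_FP (fanoutFn_mem_FP bHF_mem_FP (comp_mem_FP fstF_mem_FP ucF_mem_FP))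
/-- Membership in `FP` (`twoMF_mem_FP`). [folklore] -/
theorem twoMF_mem_FP : twoMF ∈ FP :=
  comp_mem_FP binToUnaryFn_mem_FP (fanoutFn_mem_FP pF_mem_FP
    (comp_mem_FP (append_mem_FP Kannan.zerosFn_mem_FP (const_mem_FP [true])) (comp_mem_FP lenBinF_mem_FP bHF_mem_FP)))
/-- Membership in `FP` (`TF_mem_FP`). [folklore] -/
theorem TF_mem_FP : TF ∈ FP :=
  comp_mem_FP fstF_mem_FP (comp_mem_FP padTakeFn_mem_FP (fanoutFn_mem_FP twoMF_mem_FP yF_mem_FP))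
/-- Membership in `FP` (`zF_mem_FP`). [folklore] -/
theorem zF_mem_FP : zF ∈ FP :=
  comp_mem_FP fstF_mem_FP (comp_mem_FP padTakeFn_mem_FP (fanoutFn_mem_FP mvLF_mem_FP (comp_mem_FP sndF_mem_FP ucF_mem_FP)))
/-- Membership in `FP` (`kF_mem_FP`). [folklore] -/
theorem kF_mem_FP (γ : ℕ) : kF γ ∈ FP := comp_mem_FP (onesMulFn_mem_FP γ) (comp_mem_FP lenBinF_mem_FP bHF_mem_FP)
/-- Membership in `FP` (`baseF_mem_FP`). [folklore] -/
theorem baseF_mem_FP : baseF ∈ FP :=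
  append_mem_FP (append_mem_FP (append_mem_FP xF_mem_FP aF_mem_FP) mvLF_mem_FP) (const_mem_FP _)
/-- Membership in `FP` (`nbF_mem_FP`). [folklore] -/
theorem nbF_mem_FP (K : ℕ) : nbF K ∈ FP :=
  comp_mem_FP binToUnaryFn_mem_FP (fanoutFn_mem_FP pF_mem_FP (comp_mem_FP addFn_mem_FP
    (fanoutFn_mem_FP (comp_mem_FP prodFn_mem_FP (fanoutFn_mem_FP (comp_mem_FP lenBinF_mem_FP cNF_mem_FP)
      (comp_mem_FP (powNumFn_mem_FP _) (comp_mem_FP lenBinF_mem_FP baseF_mem_FP)))) (const_mem_FP _))))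
/-- Membership in `FP` (`boardF_mem_FP`). [folklore] -/
theorem boardF_mem_FP : boardF ∈ FP := fanoutFn_mem_FP (fanoutFn_mem_FP xF_mem_FP aF_mem_FP) zF_mem_FP

/-- Membership in `FP` (`PZ_mem_FP`). [folklore] -/
theorem PZ_mem_FP : PZ ∈ FP := comp_mem_FP fstF_mem_FP fstF_mem_FP
/-- Membership in `FP` (`AZ_mem_FP`). [folklore] -/
theorem AZ_mem_FP : AZ ∈ FP := comp_mem_FP fstF_mem_FP (comp_mem_FP sndF_mem_FP fstF_mem_FP)
/-- Membership in `FP` (`TZ_mem_FP`). [folklore] -/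
theorem TZ_mem_FP : TZ ∈ FP := comp_mem_FP fstF_mem_FP (comp_mem_FP sndF_mem_FP (comp_mem_FP sndF_mem_FP fstF_mem_FP))
/-- Membership in `FP` (`NZ_mem_FP`). [folklore] -/
theorem NZ_mem_FP : NZ ∈ FP :=
  comp_mem_FP fstF_mem_FP (comp_mem_FP sndF_mem_FP (comp_mem_FP sndF_mem_FP (comp_mem_FP sndF_mem_FP fstF_mem_FP)))
/-- Membership in `FP` (`MZ_mem_FP`). [folklore] -/
theorem MZ_mem_FP : MZ ∈ FP :=
  comp_mem_FP fstF_mem_FP (comp_mem_FP sndF_mem_FP (comp_mem_FP sndF_mem_FP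
    (comp_mem_FP sndF_mem_FP (comp_mem_FP sndF_mem_FP fstF_mem_FP))))
/-- Membership in `FP` (`KZ_mem_FP`). [folklore] -/
theorem KZ_mem_FP : KZ ∈ FP :=
  comp_mem_FP fstF_mem_FP (comp_mem_FP sndF_mem_FP (comp_mem_FP sndF_mem_FP
    (comp_mem_FP sndF_mem_FP (comp_mem_FP sndF_mem_FP (comp_mem_FP sndF_mem_FP fstF_mem_FP)))))
/-- Membership in `FP` (`EZ_mem_FP`). [folklore] -/
theorem EZ_mem_FP : EZ ∈ FP :=
  comp_mem_FP sndF_mem_FP (comp_mem_FP sndF_mem_FP (comp_mem_FP sndF_mem_FP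
    (comp_mem_FP sndF_mem_FP (comp_mem_FP sndF_mem_FP (comp_mem_FP sndF_mem_FP fstF_mem_FP)))))
/-- Membership in `FP` (`IZ_mem_FP`). [folklore] -/
theorem IZ_mem_FP : IZ ∈ FP := sndF_mem_FP
/-- Membership in `FP` (`seedZ_mem_FP`). [folklore] -/
theorem seedZ_mem_FP : seedZ ∈ FP :=
  comp_mem_FP fstF_mem_FP (comp_mem_FP padTakeFn_mem_FP (fanoutFn_mem_FP KZ_mem_FP (comp_mem_FP lenBinF_mem_FP IZ_mem_FP)))
/-- Membership in `FP` (`outZ_mem_FP`). [folklore] -/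
theorem outZ_mem_FP (hF : F ∈ FP) : outZ F ∈ FP :=
  comp_mem_FP hF (fanoutFn_mem_FP TZ_mem_FP (fanoutFn_mem_FP NZ_mem_FP seedZ_mem_FP))
/-- Membership in `FP` (`rZ_mem_FP`). [folklore] -/
theorem rZ_mem_FP (hF : F ∈ FP) : rZ F ∈ FP :=
  comp_mem_FP fstF_mem_FP (comp_mem_FP padTakeFn_mem_FP (fanoutFn_mem_FP MZ_mem_FP (outZ_mem_FP hF)))
/-- Membership in `FP` (`qZ_mem_FP`). [folklore] -/
theorem qZ_mem_FP (hF : F ∈ FP) : qZ F ∈ FP :=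
  comp_mem_FP ClockedUS.Ufn_mem_FP (fanoutFn_mem_FP (fanoutFn_mem_FP EZ_mem_FP (fanoutFn_mem_FP AZ_mem_FP (rZ_mem_FP hF))) PZ_mem_FP)
/-- Membership in `FP` (`pieceZ_mem_FP`). [folklore] -/
theorem pieceZ_mem_FP (hF : F ∈ FP) : pieceZ F ∈ FP :=
  comp_mem_FP eqPairFn_mem_FP (fanoutFn_mem_FP (qZ_mem_FP hF) (const_mem_FP _))
/-- Membership in `FP` (`KX_mem_FP`). [folklore] -/
theorem KX_mem_FP : KX ∈ FP :=
  comp_mem_FP fstF_mem_FP (comp_mem_FP sndF_mem_FP (comp_mem_FP sndF_mem_FP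
    (comp_mem_FP sndF_mem_FP (comp_mem_FP sndF_mem_FP sndF_mem_FP))))
/-- Membership in `FP` (`cntNumX_mem_FP`). [folklore] -/
theorem cntNumX_mem_FP : cntNumX ∈ FP :=
  comp_mem_FP (append_mem_FP Kannan.zerosFn_mem_FP (const_mem_FP [true])) KX_mem_FP
/-- Membership in `FP` (`initX_mem_FP`). [folklore] -/
theorem initX_mem_FP : initX ∈ FP :=
  fanoutFn_mem_FP (PolyTimeComputable.id _) (fanoutFn_mem_FP cntNumX_mem_FP (const_mem_FP _))
/-- Membership in `FP` (`accX_mem_FP`). [folklore] -/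
theorem accX_mem_FP (hF : F ∈ FP) : accX F ∈ FP :=
  comp_mem_FP (sndPow_mem_FP 2)
    (comp_mem_FP (foldLoop_clipF_mem_FP 1 addFn_mem_FP length_addFn_le (pieceZ_mem_FP hF) _) initX_mem_FP)
/-- Membership in `FP` (`verdictX_mem_FP`). [folklore] -/
theorem verdictX_mem_FP (hF : F ∈ FP) : verdictX F ∈ FP :=
  comp_mem_FP ltFn_mem_FP (fanoutFn_mem_FP cntNumX_mem_FP
    (comp_mem_FP addFn_mem_FP (fanoutFn_mem_FP (accX_mem_FP hF) (accX_mem_FP hF))))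
/-- Membership in `FP` (`mkX_mem_FP`). [folklore] -/
theorem mkX_mem_FP (γ K : ℕ) : mkX γ K ∈ FP :=
  fanoutFn_mem_FP pF_mem_FP (fanoutFn_mem_FP boardF_mem_FP (fanoutFn_mem_FP TF_mem_FP
    (fanoutFn_mem_FP (nbF_mem_FP K) (fanoutFn_mem_FP mvLF_mem_FP (fanoutFn_mem_FP (kF_mem_FP γ) eRF_mem_FP)))))
/-- Membership in `FP` (`vbitF_mem_FP`). [folklore] -/
theorem vbitF_mem_FP : vbitF ∈ FP :=
  comp_mem_FP eqPairFn_mem_FP (fanoutFn_mem_FP (comp_mem_FP ClockedUS.Ufn_mem_FP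
    (fanoutFn_mem_FP (fanoutFn_mem_FP eVF_mem_FP (fanoutFn_mem_FP xhF_mem_FP yF_mem_FP)) pF_mem_FP)) (const_mem_FP _))

/-- **The body is in `FP`** (for `F ∈ FP`). [cite: AroraBarakCC2009, §1.3 (composition)] -/
theorem body_mem_FP (γ K : ℕ) (hF : F ∈ FP) : body γ K F ∈ FP :=
  andFn_mem_FP vbitF_mem_FP (comp_mem_FP (verdictX_mem_FP hF) (mkX_mem_FP γ K))

end FP

/-! ### One bit on every input -/

/-- `eqPairFn` after a fan-out with a constant answers one bit. [folklore] -/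
theorem oneBit_eqPairFn_fanout (f : List Bool → List Bool) (c : List Bool) :
    OneBit (eqPairFn ∘ fanoutFn f fun _ => c) := fun z => by
  refine ⟨decide (f z = c), ?_⟩
  rw [Function.comp_apply, fanoutFn_apply, eqPairFn_boolPair]

/-- `ltFn` after a fan-out answers one bit. [folklore] -/
theorem oneBit_ltFn_fanout (f g : List Bool → List Bool) : OneBit (ltFn ∘ fanoutFn f g) := fun z => by
  refine ⟨decide (bitsToNat (f z) < bitsToNat (g z)), ?_⟩
  rw [Function.comp_apply, fanoutFn_apply, ltFn_boolPair]

/-- **The body answers one bit on every input.** [folklore] -/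
theorem oneBit_body (γ K : ℕ) (F : List Bool → List Bool) : OneBit (body γ K F) :=
  oneBit_andFn (oneBit_eqPairFn_fanout _ _) ((oneBit_ltFn_fanout _ _).comp (mkX γ K))

/-! ### Values -/

section Values

/-- The `optionBool` code of an answer `some y` is `1 y`. [folklore] -/
theorem encode_some (y : List Bool) : ((encodingList Bool).optionBool).encode (some y) = true :: y := rfl

/-- The length of a numeral: `|bin n| = log₂ n + 1` for `n ≥ 1`. [folklore] -/
theorem length_encodeNat_eq {n : ℕ} (hn : 1 ≤ n) : (encodeNat n).length = Nat.log 2 n + 1 := by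
  have h1 : (encodeNat n).length ≤ Nat.log 2 n + 1 := TM2Pass.length_encodeNat_le n
  have h2 : n < 2 ^ (encodeNat n).length := by
    have := bitsToNat_lt (encodeNat n)
    rwa [bitsToNat_encodeNat] at this
  have h3 : 2 ^ Nat.log 2 n ≤ n := Nat.pow_log_le_self 2 (by omega)
  by_contra h
  have h4 : (encodeNat n).length ≤ Nat.log 2 n := by omega
  have h5 : 2 ^ (encodeNat n).length ≤ 2 ^ Nat.log 2 n := Nat.pow_le_pow_right two_pos h4
  omega

/-- `ones n` is the unary numeral. [folklore] -/
theorem ones_eq_unaryEncodeNat (n : ℕ) : ones n = unaryEncodeNat n := by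
  rw [OracleCompose.unaryEncodeNat_eq_replicate]

/-- `onesFn w = 1^{|w|}`. [folklore] -/
theorem onesFn_eq_ones (w : List Bool) : onesFn w = ones w.length := by
  rw [onesFn, ones_eq_unaryEncodeNat]

variable (eT eM eV eR cV cN w P u' : List Bool)

/-- The data prefix `D = ⟨e_t, ⟨e_mv, ⟨e_V, ⟨e_R, ⟨1^{c_V}, 1^{C_Nb}⟩⟩⟩⟩⟩`. [folklore] -/
abbrev dataOf : List Bool := boolPair eT (boolPair eM (boolPair eV (boolPair eR (boolPair cV cN))))
/-- The body input `Z = ⟨D, ⟨⟨w, P⟩, u'⟩⟩` (the word `w` is read as `⟨x, ⟨x_h, α⟩⟩` through the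
total projections `fstF`/`sndF`, as in `MWSim.verdictBit`). [folklore] -/
abbrev inputOf : List Bool :=
  boolPair (dataOf eT eM eV eR cV cN) (boolPair (boolPair w P) u')

/-- Value of a record field (`dF_inputOf`). [folklore] -/
@[simp] theorem dF_inputOf : dF (inputOf eT eM eV eR cV cN w P u') = dataOf eT eM eV eR cV cN := by simp [dF]
/-- Value of a record field (`wF_inputOf`). [folklore] -/
@[simp] theorem wF_inputOf : wF (inputOf eT eM eV eR cV cN w P u') = w := by simp [wF, fstF, sndF]
/-- Value of a record field (`pF_inputOf`). [folklore] -/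
@[simp] theorem pF_inputOf : pF (inputOf eT eM eV eR cV cN w P u') = P := by simp [pF, fstF, sndF]
/-- Value of a record field (`uF_inputOf`). [folklore] -/
@[simp] theorem uF_inputOf : uF (inputOf eT eM eV eR cV cN w P u') = u' := by simp [uF, sndF]
/-- Value of a record field (`xF_inputOf`). [folklore] -/
@[simp] theorem xF_inputOf : xF (inputOf eT eM eV eR cV cN w P u') = fstF w := by simp [xF, wF, fstF, sndF]
/-- Value of a record field (`xhF_inputOf`). [folklore] -/
@[simp] theorem xhF_inputOf : xhF (inputOf eT eM eV eR cV cN w P u') = fstF (sndF w) := by simp [xhF, wF, fstF, sndF]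
/-- Value of a record field (`aF_inputOf`). [folklore] -/
@[simp] theorem aF_inputOf : aF (inputOf eT eM eV eR cV cN w P u') = sndF (sndF w) := by simp [aF, wF, fstF, sndF]
/-- Value of a record field (`eTF_inputOf`). [folklore] -/
@[simp] theorem eTF_inputOf : eTF (inputOf eT eM eV eR cV cN w P u') = eT := by simp [eTF, dF, fstF]
/-- Value of a record field (`eMF_inputOf`). [folklore] -/
@[simp] theorem eMF_inputOf : eMF (inputOf eT eM eV eR cV cN w P u') = eM := by simp [eMF, dF, fstF, sndF]
/-- Value of a record field (`eVF_inputOf`). [folklore] -/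
@[simp] theorem eVF_inputOf : eVF (inputOf eT eM eV eR cV cN w P u') = eV := by simp [eVF, dF, fstF, sndF]
/-- Value of a record field (`eRF_inputOf`). [folklore] -/
@[simp] theorem eRF_inputOf : eRF (inputOf eT eM eV eR cV cN w P u') = eR := by simp [eRF, dF, fstF, sndF]
/-- Value of a record field (`cVF_inputOf`). [folklore] -/
@[simp] theorem cVF_inputOf : cVF (inputOf eT eM eV eR cV cN w P u') = cV := by simp [cVF, dF, fstF, sndF]
/-- Value of a record field (`cNF_inputOf`). [folklore] -/
@[simp] theorem cNF_inputOf : cNF (inputOf eT eM eV eR cV cN w P u') = cN := by simp [cNF, dF, fstF, sndF]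

variable {eT eM eV eR cV cN w P u'}

/-- **Value of a universal read in unary**: if the pad is `1^{Tp}`, the interpreter answers the
numeral of `v` on `⟨e Z, 1^{|inp Z|}⟩` with budget `Tp`, and `v ≤ Tp`, then `uvalF e inp Z = 1ᵛ`.
[cite: AroraBarakCC2009, Thm. 1.9 and §1.4.1] -/
theorem uvalF_apply {e inp : List Bool → List Bool} {Z : List Bool} {Tp v : ℕ} (hP : pF Z = ones Tp)
    (hrun : ClockedUS.run (boolPair (e Z) (ones (inp Z).length)) Tp = some (encodeNat v)) (hv : v ≤ Tp) :
    uvalF e inp Z = ones v := by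
  rw [uvalF, Function.comp_apply, fanoutFn_apply, hP, Function.comp_apply, Function.comp_apply,
    fanoutFn_apply, fanoutFn_apply, hP, Function.comp_apply, onesFn_eq_ones, ones_eq_unaryEncodeNat Tp,
    ClockedUS.Ufn_apply, hrun, encode_some, List.tail_cons, ← ones_eq_unaryEncodeNat,
    binToUnaryFn_boolPair, bitsToNat_encodeNat]
  simp [ones, min_eq_left hv]

/-- Value of `mulUF`: the product of the two lengths, when below the pad. [folklore] -/
theorem mulUF_apply {a b : List Bool → List Bool} {Z : List Bool} {Tp : ℕ} (hP : pF Z = ones Tp)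
    (h : (a Z).length * (b Z).length ≤ Tp) : mulUF a b Z = ones ((a Z).length * (b Z).length) := by
  rw [mulUF, Function.comp_apply, fanoutFn_apply, hP, Function.comp_apply, fanoutFn_apply, Function.comp_apply,
    Function.comp_apply, lenBinF_apply, lenBinF_apply, prodFn_boolPair, bitsToNat_encodeNat, bitsToNat_encodeNat,
    binToUnaryFn_boolPair, bitsToNat_encodeNat]
  simp [ones, min_eq_left h]

/-- `ones a ++ ones b = ones (a + b)`. [folklore] -/
theorem ones_append_ones (a b : ℕ) : ones a ++ ones b = ones (a + b) := by
  simp [ones]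

section Run

/-! The hypotheses on the interpreter's answers, the pad and the sizes. -/

variable {t mv : ℕ → ℕ} {cv cn Tp : ℕ} {rel : List Bool → List Bool → Bool}

/-- **Value of the witness bound** `1^{c_V t|x_h| + c_V}`. [folklore] -/
theorem bHF_apply (hP : P = ones Tp) (hcV : cV = ones cv)
    (htH : ClockedUS.run (boolPair eT (ones (fstF (sndF w)).length)) Tp = some (encodeNat (t (fstF (sndF w)).length)))
    (hle : cv * t (fstF (sndF w)).length ≤ Tp) (htle : t (fstF (sndF w)).length ≤ Tp) :
    bHF (inputOf eT eM eV eR cV cN w P u') = ones (cv * t (fstF (sndF w)).length + cv) := by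
  subst hP hcV
  have hp : pF (inputOf eT eM eV eR (ones cv) cN w (ones Tp) u') = ones Tp := by rw [pF_inputOf]
  have ht : tHF (inputOf eT eM eV eR (ones cv) cN w (ones Tp) u') = ones (t (fstF (sndF w)).length) :=
    uvalF_apply hp (by simpa using htH) htle
  have hm : mulUF cVF tHF (inputOf eT eM eV eR (ones cv) cN w (ones Tp) u') = ones (cv * t (fstF (sndF w)).length) := by
    have h1 := mulUF_apply (a := cVF) (b := tHF) hp (by rw [cVF_inputOf, ht]; simpa [ones] using hle)
    rw [h1, cVF_inputOf, ht]; simp [ones]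
  rw [bHF, hm, cVF_inputOf, ones_append_ones]

/-- **Value of the bound at `|w|`** `1^{c_V t|w| + c_V}`. [folklore] -/
theorem bNF_apply (hP : P = ones Tp) (hcV : cV = ones cv)
    (htN : ClockedUS.run (boolPair eT (ones w.length)) Tp = some (encodeNat (t w.length)))
    (hle : cv * t w.length ≤ Tp) (htle : t w.length ≤ Tp) :
    bNF (inputOf eT eM eV eR cV cN w P u') = ones (cv * t w.length + cv) := by
  subst hP hcV
  have hp : pF (inputOf eT eM eV eR (ones cv) cN w (ones Tp) u') = ones Tp := by rw [pF_inputOf]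
  have ht : tNF (inputOf eT eM eV eR (ones cv) cN w (ones Tp) u') = ones (t w.length) :=
    uvalF_apply hp (by simpa using htN) htle
  have hm : mulUF cVF tNF (inputOf eT eM eV eR (ones cv) cN w (ones Tp) u') =
      ones (cv * t w.length) := by
    have h1 := mulUF_apply (a := cVF) (b := tNF) hp (by rw [cVF_inputOf, ht]; simpa [ones] using hle)
    rw [h1, cVF_inputOf, ht]; simp [ones]
  rw [bNF, hm, cVF_inputOf, ones_append_ones]

/-- **Value of the move lengths** `1^{mv|x|}`, `1^{mv|w|}`. [folklore] -/
theorem mvLF_apply (hP : P = ones Tp)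
    (hmv : ClockedUS.run (boolPair eM (ones (fstF w).length)) Tp = some (encodeNat (mv (fstF w).length))) (hle : mv (fstF w).length ≤ Tp) :
    mvLF (inputOf eT eM eV eR cV cN w P u') = ones (mv (fstF w).length) :=
  uvalF_apply (by rw [pF_inputOf, hP]) (by simpa using hmv) hle

/-- Value of `mvNF`. [folklore] -/
theorem mvNF_apply (hP : P = ones Tp)
    (hmv : ClockedUS.run (boolPair eM (ones w.length)) Tp = some (encodeNat (mv w.length)))
    (hle : mv w.length ≤ Tp) :
    mvNF (inputOf eT eM eV eR cV cN w P u') = ones (mv w.length) :=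
  uvalF_apply (by rw [pF_inputOf, hP]) (by simpa using hmv) hle

end Run

section Stages

variable {Tp : ℕ}

/-- The body input, abbreviated. [folklore] -/
local notation "Z" => inputOf eT eM eV eR cV cN w P u'

/-- Value of the kept length `1^{2 B_N + M_N + 2}`. [folklore] -/
theorem UF_apply {BN MN : ℕ} (hbN : bNF Z = ones BN) (hmvN : mvNF Z = ones MN) :
    UF Z = ones (BN + BN + MN + 2) := by
  rw [UF, hbN, hmvN, ones_append_ones, ones_append_ones]
  simp [ones, List.replicate_succ']

/-- Value of the cut guess `u' ↾ U`. [folklore] -/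
theorem ucF_apply {Uv : ℕ} (hU : UF Z = ones Uv) : ucF Z = u'.take Uv := by
  rw [ucF, Function.comp_apply, fanoutFn_apply, hU, uF_inputOf, takeFn_boolPair]
  simp [ones]

/-- Value of the witness `(fst u_c) ↾ B`. [folklore] -/
theorem yF_apply {B Uv : ℕ} (hb : bHF Z = ones B) (hU : UF Z = ones Uv) :
    yF Z = (fstF (u'.take Uv)).take B := by
  rw [yF, Function.comp_apply, fanoutFn_apply, hb, Function.comp_apply, ucF_apply hU, takeFn_boolPair]
  simp [ones]

/-- Value of `2^M` in unary, `M = |bin B|`. [folklore] -/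
theorem twoMF_apply (hP : P = ones Tp) {B : ℕ} (hb : bHF Z = ones B)
    (h2 : 2 ^ (encodeNat B).length ≤ Tp) : twoMF Z = ones (2 ^ (encodeNat B).length) := by
  subst hP
  rw [twoMF, Function.comp_apply, fanoutFn_apply, pF_inputOf, Function.comp_apply, Function.comp_apply,
    hb, lenBinF_apply, Kannan.zerosFn_apply, ← Com.encodeNat_two_pow, binToUnaryFn_boolPair, bitsToNat_encodeNat]
  simp [ones, min_eq_left h2]

/-- Value of the table: the witness padded by `0`s to `2^M` bits. [folklore] -/
theorem TF_apply {W : ℕ} (h2 : twoMF Z = ones W) : TF Z = List.takeD W (yF Z) false := by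
  rw [TF, Function.comp_apply, Function.comp_apply, fanoutFn_apply, h2, padTakeFn_boolPair, fstF_boolPair]
  simp [ones]

/-- Value of Merlin's message `takeD (mv|x|) (snd u_c)`. [folklore] -/
theorem zF_apply {ML Uv : ℕ} (hmv : mvLF Z = ones ML) (hU : UF Z = ones Uv) :
    zF Z = List.takeD ML (sndF (u'.take Uv)) false := by
  rw [zF, Function.comp_apply, Function.comp_apply, fanoutFn_apply, hmv, Function.comp_apply, ucF_apply hU,
    padTakeFn_boolPair, fstF_boolPair]
  simp [ones]

/-- Value of the seed length `1^{γ M}`. [folklore] -/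
theorem kF_apply (γ : ℕ) {B : ℕ} (hb : bHF Z = ones B) : kF γ Z = ones (γ * (encodeNat B).length) := by
  rw [kF, Function.comp_apply, Function.comp_apply, hb, lenBinF_apply]
  simp [onesMulFn, ones]

/-- Value of the base of the output length. [folklore] -/
theorem baseF_apply {ML : ℕ} (hmv : mvLF Z = ones ML) : baseF Z = fstF w ++ sndF (sndF w) ++ ones ML ++ [true, true] := by
  rw [baseF, xF_inputOf, aF_inputOf, hmv]

/-- Value of the output length `1^{C_Nb · base^{2K+2} + 7}`. [folklore] -/
theorem nbF_apply (K : ℕ) (hP : P = ones Tp) {cn ML : ℕ} (hcN : cN = ones cn) (hmv : mvLF Z = ones ML)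
    (hle : cn * ((fstF w).length + (sndF (sndF w)).length + ML + 2) ^ (2 * K + 2) + 7 ≤ Tp) :
    nbF K Z = ones (cn * ((fstF w).length + (sndF (sndF w)).length + ML + 2) ^ (2 * K + 2) + 7) := by
  have hlen : (baseF Z).length = (fstF w).length + (sndF (sndF w)).length + ML + 2 := by
    rw [baseF_apply hmv]; simp [ones]; omega
  subst hP hcN
  rw [nbF, Function.comp_apply, fanoutFn_apply, pF_inputOf, Function.comp_apply, fanoutFn_apply, Function.comp_apply,
    fanoutFn_apply, Function.comp_apply, cNF_inputOf, Function.comp_apply, Function.comp_apply, lenBinF_apply,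
    lenBinF_apply, hlen, powNumFn_encodeNat, prodFn_boolPair, bitsToNat_encodeNat, bitsToNat_encodeNat, addFn_boolPair,
    bitsToNat_encodeNat, bitsToNat_encodeNat, binToUnaryFn_boolPair, bitsToNat_encodeNat]
  simp [ones, min_eq_left hle]

/-- Value of the board `⟨⟨x, α⟩, z⟩`. [folklore] -/
theorem boardF_apply : boardF Z = boolPair (boolPair (fstF w) (sndF (sndF w))) (zF Z) := by
  rw [boardF, fanoutFn_apply, fanoutFn_apply, xF_inputOf, aF_inputOf]

/-- Value of the record maker. [folklore] -/
theorem mkX_apply (γ K : ℕ) : mkX γ K Z =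
    boolPair P (boolPair (boardF Z) (boolPair (TF Z) (boolPair (nbF K Z) (boolPair (mvLF Z) (boolPair (kF γ Z) eR))))) := by
  simp only [mkX, fanoutFn_apply, pF_inputOf, eRF_inputOf]

end Stages

/-! ### Values of the fold -/

section Fold

variable (F : List Bool → List Bool) (P A T eR : List Bool) (nb m k : ℕ)

/-- The fold record `X = ⟨P, ⟨A, ⟨T, ⟨1^{nb}, ⟨1^{m}, ⟨1^{k}, e_R⟩⟩⟩⟩⟩⟩`. [folklore] -/
abbrev recX : List Bool := boolPair P (boolPair A (boolPair T (boolPair (ones nb) (boolPair (ones m) (boolPair (ones k) eR)))))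

/-- Value of a record field (`PZ_rec`). [folklore] -/
@[simp] theorem PZ_rec (i : List Bool) : PZ (boolPair (recX P A T eR nb m k) i) = P := by simp [PZ, fstF]
/-- Value of a record field (`AZ_rec`). [folklore] -/
@[simp] theorem AZ_rec (i : List Bool) : AZ (boolPair (recX P A T eR nb m k) i) = A := by simp [AZ, fstF, sndF]
/-- Value of a record field (`TZ_rec`). [folklore] -/
@[simp] theorem TZ_rec (i : List Bool) : TZ (boolPair (recX P A T eR nb m k) i) = T := by simp [TZ, fstF, sndF]
/-- Value of a record field (`NZ_rec`). [folklore] -/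
@[simp] theorem NZ_rec (i : List Bool) : NZ (boolPair (recX P A T eR nb m k) i) = ones nb := by simp [NZ, fstF, sndF]
/-- Value of a record field (`MZ_rec`). [folklore] -/
@[simp] theorem MZ_rec (i : List Bool) : MZ (boolPair (recX P A T eR nb m k) i) = ones m := by simp [MZ, fstF, sndF]
/-- Value of a record field (`KZ_rec`). [folklore] -/
@[simp] theorem KZ_rec (i : List Bool) : KZ (boolPair (recX P A T eR nb m k) i) = ones k := by simp [KZ, fstF, sndF]
/-- Value of a record field (`EZ_rec`). [folklore] -/
@[simp] theorem EZ_rec (i : List Bool) : EZ (boolPair (recX P A T eR nb m k) i) = eR := by simp [EZ, fstF, sndF]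
/-- Value of a record field (`IZ_rec`). [folklore] -/
@[simp] theorem IZ_rec (i : List Bool) : IZ (boolPair (recX P A T eR nb m k) i) = i := by simp [IZ, sndF]
/-- Value of a record field (`KX_rec`). [folklore] -/
@[simp] theorem KX_rec : KX (recX P A T eR nb m k) = ones k := by simp [KX, fstF, sndF]

/-- The coins of round `i`: `takeD m (F ⟨T, ⟨1^{nb}, takeD k (bin i)⟩⟩)`. [folklore] -/
abbrev coins (i : ℕ) : List Bool :=
  List.takeD m (F (boolPair T (boolPair (ones nb) (List.takeD k (encodeNat i) false)))) false

/-- Value of the seed of round `i`. [folklore] -/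
theorem seedZ_rec (i : ℕ) : seedZ (boolPair (recX P A T eR nb m k) (ones i)) = List.takeD k (encodeNat i) false := by
  simp [seedZ, ones]

/-- Value of the coins of round `i`. [folklore] -/
theorem rZ_rec (i : ℕ) : rZ F (boolPair (recX P A T eR nb m k) (ones i)) = coins F T nb m k i := by
  simp [rZ, outZ, seedZ_rec, ones]

/-- **Value of the universal query of round `i`**: the code of the interpreter's answer on
`⟨e_R, ⟨A, coinsᵢ⟩⟩` with budget `Tp`. [cite: AroraBarakCC2009, Thm. 1.9 and §1.4.1] -/
theorem qZ_rec {Tp : ℕ} (hP : P = ones Tp) (i : ℕ) :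
    qZ F (boolPair (recX P A T eR nb m k) (ones i)) =
      ((encodingList Bool).optionBool).encode (ClockedUS.run (boolPair eR (boolPair A (coins F T nb m k i))) Tp) := by
  rw [qZ, Function.comp_apply, fanoutFn_apply, fanoutFn_apply, fanoutFn_apply, EZ_rec, AZ_rec, rZ_rec, PZ_rec, hP,
    ones_eq_unaryEncodeNat, ClockedUS.Ufn_apply]

/-- **Value of the piece of round `i`**: the interpreter's answer bit `b`. [folklore] -/
theorem pieceZ_rec {Tp : ℕ} (hP : P = ones Tp) (i : ℕ) {b : Bool}
    (hR : ClockedUS.run (boolPair eR (boolPair A (coins F T nb m k i))) Tp = some [b]) :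
    pieceZ F (boolPair (recX P A T eR nb m k) (ones i)) = [b] := by
  rw [pieceZ, Function.comp_apply, fanoutFn_apply, qZ_rec F P A T eR nb m k hP, hR, encode_some, eqPairFn_boolPair]
  cases b <;> decide

/-- The piece is one symbol long on every input. [folklore] -/
theorem length_pieceZ (w : List Bool) : (pieceZ F w).length = 1 :=
  (oneBit_eqPairFn_fanout (qZ F) [true, true]).length_eq w

/-- Value of the seed-count numeral `bin 2^k`. [folklore] -/
theorem cntNumX_rec : cntNumX (recX P A T eR nb m k) = encodeNat (2 ^ k) := by
  rw [cntNumX, Function.comp_apply, KX_rec, Kannan.zerosFn_apply, Com.encodeNat_two_pow]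
  simp [ones]

/-- The empty pair is `⟨1⁰, bin 0⟩`. [folklore] -/
theorem boolPair_nil_nil : boolPair ([] : List Bool) [] = boolPair (ones 0) (encodeNat 0) := rfl

/-- Value of the fold's initial state. [folklore] -/
theorem initX_rec : initX (recX P A T eR nb m k) =
    boolPair (recX P A T eR nb m k) (boolPair (encodeNat (2 ^ k)) (boolPair (ones 0) (encodeNat 0))) := by
  rw [initX, fanoutFn_apply, fanoutFn_apply, cntNumX_rec, boolPair_nil_nil]

/-- **Value of the counted fold** on a record whose length covers all `2^k` rounds: the number of
rounds whose answer bit is `1`. [cite: AroraBarakCC2009, Lemma 20.3 (proof)] -/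
theorem accX_rec {Tp : ℕ} (hP : P = ones Tp) (hcap : 2 ^ k ≤ (recX P A T eR nb m k).length)
    {b : ℕ → Bool} (hR : ∀ i, i < 2 ^ k → ClockedUS.run (boolPair eR (boolPair A (coins F T nb m k i))) Tp = some [b i]) :
    accX F (recX P A T eR nb m k) = encodeNat (∑ i ∈ Finset.range (2 ^ k), (b i).toNat) := by
  have hk : 2 ^ k ≤ (X : Polynomial ℕ).eval (recX P A T eR nb m k).length := by rw [eval_X]; exact hcap
  rw [accX, Function.comp_apply, Function.comp_apply, initX_rec, foldLoop_apply addFn _ hk 0 (encodeNat 0),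
    sndPow_succ_boolPair, sndPow_succ_boolPair, sndPow_zero_boolPair,
    foldAcc_clipF (fun i _ _ => by rw [length_pieceZ]; omega), foldAcc_addFn]
  refine congrArg encodeNat ?_
  rw [zero_add]
  refine Finset.sum_congr rfl fun i hi => ?_
  have hb : ∀ bb : Bool, bitsToNat [bb] = bb.toNat := fun bb => by rw [bitsToNat_cons]; simp
  rw [zero_add, pieceZ_rec F P A T eR nb m k hP i (hR i (Finset.mem_range.1 hi)), hb]

/-- **Value of the verdict** on such a record: `[2^k < 2 · #accepting rounds]`.
[cite: AroraBarakCC2009, Lemma 20.3 (proof)] -/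
theorem verdictX_rec {Tp : ℕ} (hP : P = ones Tp) (hcap : 2 ^ k ≤ (recX P A T eR nb m k).length)
    {b : ℕ → Bool} (hR : ∀ i, i < 2 ^ k → ClockedUS.run (boolPair eR (boolPair A (coins F T nb m k i))) Tp = some [b i]) :
    verdictX F (recX P A T eR nb m k) = [decide (2 ^ k < 2 * ∑ i ∈ Finset.range (2 ^ k), (b i).toNat)] := by
  simp [verdictX, cntNumX_rec, accX_rec F P A T eR nb m k hP hcap hR, two_mul]

end Fold

/-! ### Value of the body -/

section Body

variable {Tp : ℕ}

/-- **Value of the verifier's bit**: the interpreter's answer bit on `⟨e_V, ⟨x_h, y⟩⟩`. [folklore] -/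
theorem vbitF_apply (hP : P = ones Tp) {yv : List Bool} (hy : yF (inputOf eT eM eV eR cV cN w P u') = yv)
    {bv : Bool} (hV : ClockedUS.run (boolPair eV (boolPair (fstF (sndF w)) yv)) Tp = some [bv]) :
    vbitF (inputOf eT eM eV eR cV cN w P u') = [bv] := by
  rw [vbitF, Function.comp_apply, fanoutFn_apply, Function.comp_apply, fanoutFn_apply, fanoutFn_apply, fanoutFn_apply,
    eVF_inputOf, xhF_inputOf, hy, pF_inputOf, hP, ones_eq_unaryEncodeNat, ClockedUS.Ufn_apply, hV, encode_some,
    eqPairFn_boolPair]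
  cases bv <;> decide

/-- **Value of the body on a well-formed input** whose stages evaluate as stated: the verifier's
bit AND the majority verdict over the `2^k` rounds. [cite: MurrayWilliams2018, Lemma 4.1 (proof)] -/
theorem body_apply_of_stages (γ K : ℕ) (F : List Bool → List Bool) (hP : P = ones Tp)
    {yv zv Tv : List Bool} {nb ML k : ℕ}
    (hy : yF (inputOf eT eM eV eR cV cN w P u') = yv)
    (hz : zF (inputOf eT eM eV eR cV cN w P u') = zv)
    (hT : TF (inputOf eT eM eV eR cV cN w P u') = Tv)
    (hnb : nbF K (inputOf eT eM eV eR cV cN w P u') = ones nb)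
    (hmv : mvLF (inputOf eT eM eV eR cV cN w P u') = ones ML)
    (hk : kF γ (inputOf eT eM eV eR cV cN w P u') = ones k)
    (hcap : 2 ^ k ≤ (recX P (boolPair (boolPair (fstF w) (sndF (sndF w))) zv) Tv eR nb ML k).length)
    {bv : Bool} (hV : ClockedUS.run (boolPair eV (boolPair (fstF (sndF w)) yv)) Tp = some [bv])
    {b : ℕ → Bool} (hR : ∀ i, i < 2 ^ k →
      ClockedUS.run (boolPair eR (boolPair (boolPair (boolPair (fstF w) (sndF (sndF w))) zv) (coins F Tv nb ML k i))) Tp = some [b i]) :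
    body γ K F (inputOf eT eM eV eR cV cN w P u') =
      [bv && decide (2 ^ k < 2 * ∑ i ∈ Finset.range (2 ^ k), (b i).toNat)] := by
  have hrec : mkX γ K (inputOf eT eM eV eR cV cN w P u') =
      recX P (boolPair (boolPair (fstF w) (sndF (sndF w))) zv) Tv eR nb ML k := by
    rw [mkX_apply, boardF_apply, hz, hT, hnb, hmv, hk]
  refine andFn_apply (vbitF_apply hP hy hV) ?_
  rw [Function.comp_apply, hrec, verdictX_rec F P _ Tv eR nb ML k hP hcap hR]

end Body

end Values

/-! ### The running time of `N` (hypothesis `hN` of the conditional Lemma 4.1) -/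

section Time

/-- The overhead polynomial of a code is linear: `pM(s) = haltAddr · s`. [folklore] -/
theorem pM_eval (M : TM2ComputableAux Bool Bool) (s : ℕ) :
    (ClockedUA.pM M).eval s = FlatProg.haltAddr (ClockedUA.cM M) * s := by
  simp [ClockedUA.pM]

/-- `progM M w = ⟨ecode M, w⟩`. [folklore] -/
theorem progM_eq (M : TM2ComputableAux Bool Bool) (w : List Bool) :
    ClockedUS.progM M w = boolPair (ClockedUS.ecode M) w := rfl

/-- Affine powers are dominated: `a (b x + c)^d + a' ≤ A (x+1)^E + A` for `d ≤ E`, with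
`A = a (b + c)^d + a'`. [folklore] -/
theorem affine_pow_le (a b c d a' E : ℕ) (hd : d ≤ E) (x : ℕ) :
    a * (b * x + c) ^ d + a' ≤ (a * (b + c) ^ d + a') * (x + 1) ^ E + (a * (b + c) ^ d + a') := by
  have h1 : b * x + c ≤ (b + c) * (x + 1) := by nlinarith
  have h2 : (b * x + c) ^ d ≤ (b + c) ^ d * (x + 1) ^ d := by
    rw [← mul_pow]; exact Nat.pow_le_pow_left h1 _
  have h3 : (x + 1) ^ d ≤ (x + 1) ^ E := Nat.pow_le_pow_right (Nat.succ_pos x) hd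
  have h4 : a * (b * x + c) ^ d ≤ a * (b + c) ^ d * (x + 1) ^ E := by
    calc a * (b * x + c) ^ d ≤ a * ((b + c) ^ d * (x + 1) ^ d) := Nat.mul_le_mul_left _ h2
      _ ≤ a * ((b + c) ^ d * (x + 1) ^ E) := Nat.mul_le_mul_left _ (Nat.mul_le_mul_left _ h3)
      _ = a * (b + c) ^ d * (x + 1) ^ E := by ring
  have h5 : a * (b + c) ^ d * (x + 1) ^ E ≤ (a * (b + c) ^ d + a') * (x + 1) ^ E :=
    Nat.mul_le_mul_right _ (Nat.le_add_right _ _)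
  exact Nat.add_le_add (h4.trans h5) (Nat.le_add_left _ _)

/-- A dominated bound stays dominated by a larger constant. [folklore] -/
theorem le_pad_of_le {f : ℕ} {A A' x E : ℕ} (h : f ≤ A * (x + 1) ^ E + A) (hA : A ≤ A') :
    f ≤ A' * (x + 1) ^ E + A' :=
  h.trans (Nat.add_le_add (Nat.mul_le_mul_right _ hA) hA)

/-- `(x + 1)^m ≤ 2^m x^m + 1`. [folklore] -/
theorem succ_pow_le (x m : ℕ) : (x + 1) ^ m ≤ 2 ^ m * x ^ m + 1 := by
  rcases Nat.eq_zero_or_pos x with rfl | hx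
  · simp
  · have : x + 1 ≤ 2 * x := by omega
    calc (x + 1) ^ m ≤ (2 * x) ^ m := Nat.pow_le_pow_left this _
      _ = 2 ^ m * x ^ m := by rw [mul_pow]
      _ ≤ 2 ^ m * x ^ m + 1 := Nat.le_succ _

end Time

/-! ### The body computes `verdictBit`, and `simLang ∈ NTIME (t · ^ E)` -/

section Main

variable {t mv : ℕ → ℕ} {L : Language Bool} (V : NVerifier t L) (Ref : Language Bool)
  (F : List Bool → List Bool) (γ K CNb C₀ : ℕ)

/-- The constant of a verifier is positive (it answers on `⟨ε, ε⟩` within `c · t 0 + c` steps, and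
no machine answers within `0` steps). [folklore] -/
theorem one_le_c : 1 ≤ V.c := by
  by_contra h
  have h0 : V.c = 0 := by omega
  have := V.outputsWithin [] [] (by simp)
  rw [h0] at this
  simp only [zero_mul, zero_add] at this
  exact not_outputsWithin_zero _ _ _ this

/-- `fstF`, `sndF` do not lengthen. [folklore] -/
theorem length_parts_le (w : List Bool) :
    (fstF w).length ≤ w.length ∧ (fstF (sndF w)).length ≤ w.length ∧ (sndF (sndF w)).length ≤ w.length := by
  have h1 := length_fstF_sndF_le w
  have h2 := length_fstF_sndF_le (sndF w)
  omega

/-- **The body computes `verdictBit` on an adequate pad.** With the data prefix made of the codes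
of the constructors of `t`, `mv`, of the verifier's machine and of Arthur's predicate and of the
constants `1^{c_V}`, `1^{C_Nb}`, and a pad `1^{Tp}` exceeding the listed thresholds at the input
length `|w|`, the body's bit is `MWSim.verdictBit` (output length
`Nb ℓ a = C_Nb (ℓ + a + mv ℓ + 2)^{2K+2} + 7`, kept length `2 (c_V t N + c_V) + mv N + 2`).
[cite: MurrayWilliams2018, Lemma 4.1 (proof)] -/
theorem body_eq_verdictBit (htm : Monotone t) (hmvm : Monotone mv) (hC₀ : ∀ n, mv n ≤ t n + C₀)
    (hge : ∀ n, n ≤ t n)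
    {Mt Mm MR : TM2ComputableAux Bool Bool} {ct cm cR : ℕ}
    (hMt : ∀ n, Mt.OutputsWithin (unaryEncodeNat n) (encodeNat (t n)) (ct * t n + ct))
    (hMm : ∀ n, Mm.OutputsWithin (unaryEncodeNat n) (encodeNat (mv n)) (cm * mv n + cm))
    (hMR : ∀ z : List Bool, MR.OutputsWithin z [Ref.boolIndicator z] (cR * z.length ^ K + cR))
    (w u' : List Bool) {Tp : ℕ}
    (h1 : FlatProg.haltAddr (ClockedUA.cM Mt) * (ct * t w.length + ct) ≤ Tp)
    (h2 : FlatProg.haltAddr (ClockedUA.cM Mm) * (cm * mv w.length + cm) ≤ Tp)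
    (h3 : FlatProg.haltAddr (ClockedUA.cM V.machine) * (V.c * t w.length + V.c) ≤ Tp)
    (h4 : FlatProg.haltAddr (ClockedUA.cM MR) * (cR * (15 * t w.length + 3 * C₀ + 14) ^ K + cR) ≤ Tp)
    (h6 : 2 * (V.c * t w.length + V.c) ≤ Tp) (h7 : t w.length + C₀ ≤ Tp)
    (h8 : CNb * (3 * t w.length + C₀ + 2) ^ (2 * K + 2) + 7 ≤ Tp)
    (h9 : (2 * (V.c * t w.length + V.c)) ^ γ ≤ Tp) :
    body γ K F (inputOf (ClockedUS.ecode Mt) (ClockedUS.ecode Mm) (ClockedUS.ecode V.machine) (ClockedUS.ecode MR)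
        (ones V.c) (ones CNb) w (ones Tp) u') =
      [verdictBit t V Ref F γ mv (fun ℓ a => CNb * (ℓ + a + mv ℓ + 2) ^ (2 * K + 2) + 7)
        (fun N => 2 * bound t V N + mv N + 2) w u'] := by
  -- names
  set Z : List Bool := inputOf (ClockedUS.ecode Mt) (ClockedUS.ecode Mm) (ClockedUS.ecode V.machine) (ClockedUS.ecode MR)
    (ones V.c) (ones CNb) w (ones Tp) u' with hZ
  obtain ⟨hxN, hxhN, hαN⟩ := length_parts_le w
  have hVc := one_le_c V
  have hrun : ∀ (M : TM2ComputableAux Bool Bool) {inp y : List Bool} {sM : ℕ}, M.OutputsWithin inp y sM →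
      FlatProg.haltAddr (ClockedUA.cM M) * sM ≤ Tp → ClockedUS.run (boolPair (ClockedUS.ecode M) inp) Tp = some y := by
    intro M inp y sM h hb
    rw [← progM_eq]
    exact ClockedUS.run_eq_some M h (by rw [pM_eval]; exact hb)
  -- the four interpreter answers on the constructors
  have htN' : t (fstF (sndF w)).length ≤ t w.length := htm hxhN
  have hmvx : mv (fstF w).length ≤ mv w.length := hmvm hxN
  have hmvNC : mv w.length ≤ t w.length + C₀ := hC₀ w.length
  have hNt : w.length ≤ t w.length := hge w.length
  have htH : ClockedUS.run (boolPair (ClockedUS.ecode Mt) (ones (fstF (sndF w)).length)) Tp =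
      some (encodeNat (t (fstF (sndF w)).length)) :=
    hrun Mt (by rw [ones_eq_unaryEncodeNat]; exact hMt _)
      (h1.trans' (Nat.mul_le_mul_left _ (Nat.add_le_add_right (Nat.mul_le_mul_left _ htN') _)))
  have htN : ClockedUS.run (boolPair (ClockedUS.ecode Mt) (ones w.length)) Tp = some (encodeNat (t w.length)) :=
    hrun Mt (by rw [ones_eq_unaryEncodeNat]; exact hMt _) h1
  have hmvL : ClockedUS.run (boolPair (ClockedUS.ecode Mm) (ones (fstF w).length)) Tp = some (encodeNat (mv (fstF w).length)) :=
    hrun Mm (by rw [ones_eq_unaryEncodeNat]; exact hMm _)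
      (h2.trans' (Nat.mul_le_mul_left _ (Nat.add_le_add_right (Nat.mul_le_mul_left _ hmvx) _)))
  have hmvN : ClockedUS.run (boolPair (ClockedUS.ecode Mm) (ones w.length)) Tp = some (encodeNat (mv w.length)) :=
    hrun Mm (by rw [ones_eq_unaryEncodeNat]; exact hMm _) h2
  -- sizes
  have hcvle : V.c * t (fstF (sndF w)).length ≤ V.c * t w.length := Nat.mul_le_mul_left _ htN'
  have hcvt : V.c * t (fstF (sndF w)).length ≤ Tp := by omega
  have htle : t (fstF (sndF w)).length ≤ Tp := by omega
  have hcvtN : V.c * t w.length ≤ Tp := by omega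
  have htleN : t w.length ≤ Tp := by omega
  have hmvle : mv (fstF w).length ≤ Tp := hmvx.trans ((hC₀ _).trans h7)
  have hmvleN : mv w.length ≤ Tp := (hC₀ _).trans h7
  -- stage values
  set B : ℕ := V.c * t (fstF (sndF w)).length + V.c with hB
  set BN : ℕ := V.c * t w.length + V.c with hBN
  have hB1 : 1 ≤ B := le_add_left hVc
  have hb : bHF Z = ones B := bHF_apply (eM := ClockedUS.ecode Mm) (eV := ClockedUS.ecode V.machine)
    (eR := ClockedUS.ecode MR) (cN := ones CNb) (w := w) (u' := u') rfl rfl htH hcvt htle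
  have hbN : bNF Z = ones BN := bNF_apply (eM := ClockedUS.ecode Mm) (eV := ClockedUS.ecode V.machine)
    (eR := ClockedUS.ecode MR) (cN := ones CNb) (w := w) (u' := u') rfl rfl htN hcvtN htleN
  have hmL : mvLF Z = ones (mv (fstF w).length) := mvLF_apply (eT := ClockedUS.ecode Mt) (eV := ClockedUS.ecode V.machine)
    (eR := ClockedUS.ecode MR) (cV := ones V.c) (cN := ones CNb) (w := w) (u' := u') rfl hmvL hmvle
  have hmN : mvNF Z = ones (mv w.length) := mvNF_apply (eT := ClockedUS.ecode Mt) (eV := ClockedUS.ecode V.machine)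
    (eR := ClockedUS.ecode MR) (cV := ones V.c) (cN := ones CNb) (w := w) (u' := u') rfl hmvN hmvleN
  set Uv : ℕ := BN + BN + mv w.length + 2 with hUv
  have hU : UF Z = ones Uv := UF_apply hbN hmN
  have hy : yF Z = (fstF (u'.take Uv)).take B := yF_apply hb hU
  have h2B : 2 ^ (encodeNat B).length ≤ 2 * B := by
    rw [length_encodeNat_eq hB1, pow_succ]
    have : 2 ^ Nat.log 2 B ≤ B := Nat.pow_log_le_self 2 (by omega)
    omega
  have h2M : 2 ^ (encodeNat B).length ≤ Tp := by omega
  have htwo : twoMF Z = ones (2 ^ (encodeNat B).length) := twoMF_apply rfl hb h2M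
  have hT : TF Z = List.takeD (2 ^ (encodeNat B).length) ((fstF (u'.take Uv)).take B) false := by
    rw [TF_apply htwo, hy]
  have hz : zF Z = List.takeD (mv (fstF w).length) (sndF (u'.take Uv)) false := zF_apply hmL hU
  have hk : kF γ Z = ones (γ * (encodeNat B).length) := kF_apply γ hb
  set nb : ℕ := CNb * ((fstF w).length + (sndF (sndF w)).length + mv (fstF w).length + 2) ^ (2 * K + 2) + 7 with hnb
  have hnble : nb ≤ Tp := by
    refine le_trans ?_ h8
    have hbase : (fstF w).length + (sndF (sndF w)).length + mv (fstF w).length + 2 ≤ 3 * t w.length + C₀ + 2 := by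
      omega
    exact Nat.add_le_add_right (Nat.mul_le_mul_left _ (Nat.pow_le_pow_left hbase _)) _
  have hnbv : nbF K Z = ones nb := nbF_apply K rfl rfl hmL hnble
  -- capacity of the fold record
  have hcap : 2 ^ (γ * (encodeNat B).length) ≤
      (recX (ones Tp) (boolPair (boolPair (fstF w) (sndF (sndF w))) (List.takeD (mv (fstF w).length) (sndF (u'.take Uv)) false))
        (List.takeD (2 ^ (encodeNat B).length) ((fstF (u'.take Uv)).take B) false) (ClockedUS.ecode MR) nb
        (mv (fstF w).length) (γ * (encodeNat B).length)).length := by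
    have h1 : 2 ^ (γ * (encodeNat B).length) ≤ Tp := by
      rw [mul_comm, pow_mul]
      refine le_trans (Nat.pow_le_pow_left ?_ γ) h9
      omega
    refine h1.trans ?_
    simp only [length_boolPair, ones, List.length_replicate]
    omega
  -- the verifier's answer
  have hyB : ((fstF (u'.take Uv)).take B).length ≤ V.c * t (fstF (sndF w)).length + V.c := List.length_take_le _ _
  have hV : ClockedUS.run (boolPair (ClockedUS.ecode V.machine) (boolPair (fstF (sndF w)) ((fstF (u'.take Uv)).take B))) Tp =
      some [V.rel (fstF (sndF w)) ((fstF (u'.take Uv)).take B)] :=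
    hrun V.machine (V.outputsWithin _ _ hyB)
      (h3.trans' (Nat.mul_le_mul_left _ (Nat.add_le_add_right hcvle _)))
  -- Arthur's answers
  have hR : ∀ i, i < 2 ^ (γ * (encodeNat B).length) →
      ClockedUS.run (boolPair (ClockedUS.ecode MR) (boolPair
        (boolPair (boolPair (fstF w) (sndF (sndF w))) (List.takeD (mv (fstF w).length) (sndF (u'.take Uv)) false))
        (coins F (List.takeD (2 ^ (encodeNat B).length) ((fstF (u'.take Uv)).take B) false) nb (mv (fstF w).length)
          (γ * (encodeNat B).length) i))) Tp =
      some [Ref.boolIndicator (boolPair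
        (boolPair (boolPair (fstF w) (sndF (sndF w))) (List.takeD (mv (fstF w).length) (sndF (u'.take Uv)) false))
        (coins F (List.takeD (2 ^ (encodeNat B).length) ((fstF (u'.take Uv)).take B) false) nb (mv (fstF w).length)
          (γ * (encodeNat B).length) i))] := by
    intro i _
    refine hrun MR (hMR _) (h4.trans' (Nat.mul_le_mul_left _ ?_))
    refine Nat.add_le_add_right (Nat.mul_le_mul_left _ (Nat.pow_le_pow_left ?_ _)) _
    simp only [length_boolPair, List.takeD_length]
    omega
  -- the body
  rw [body_apply_of_stages γ K F rfl hy hz hT hnbv hmL hk hcap hV hR]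
  -- `verdictBit`, unfolded
  have hscale : scale t V (fstF (sndF w)).length = (encodeNat B).length := by
    rw [scale, length_encodeNat_eq hB1]
    rfl
  have hUw : 2 * bound t V w.length + mv w.length + 2 = Uv := by
    simp only [hUv, hBN, bound]; ring
  have hbd : bound t V (fstF (sndF w)).length = B := rfl
  rw [verdictBit]
  simp only [hUw, witOf, tableOf, hbd, hscale, accCount, coins, ones_eq_unaryEncodeNat, hnb]

end Main

section NTIME

variable {t mv : ℕ → ℕ} {L : Language Bool}

/-- `verdictBit` depends on the guess only through its kept prefix. [folklore] -/
theorem verdictBit_take (V : NVerifier t L) (Ref : Language Bool) (F : List Bool → List Bool) (γ : ℕ)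
    (Nb : ℕ → ℕ → ℕ) (U : ℕ → ℕ) (w u : List Bool) :
    verdictBit t V Ref F γ mv Nb U w (u.take (U w.length)) = verdictBit t V Ref F γ mv Nb U w u := by
  simp only [verdictBit, List.take_take, min_self]

/-- **The padded-body language of the body is the simulation language**, once the body computes
`verdictBit` on the pad `T` and the kept length is below `2|w| + T|w| + 2`. [folklore] -/
theorem lang_body_eq_simLang (V : NVerifier t L) (Ref : Language Bool) (F : List Bool → List Bool) (γ K : ℕ)
    (Nb : ℕ → ℕ → ℕ) (U T : ℕ → ℕ) (D : List Bool)
    (hU : ∀ N, U N ≤ 2 * N + T N + 2)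
    (hbody : ∀ w u : List Bool,
      body γ K F (boolPair D (boolPair (boolPair w (ones (T w.length))) u)) = [verdictBit t V Ref F γ mv Nb U w u]) :
    PadVerif.lang (body γ K F) D T = simLang t V Ref F γ mv Nb U := by
  ext w
  rw [PadVerif.mem_lang_iff]
  change _ ↔ ∃ u : List Bool, u.length ≤ U w.length ∧ verdictBit t V Ref F γ mv Nb U w u = true
  have hun : UnaryClock.un (T w.length) = ones (T w.length) := rfl
  constructor
  · rintro ⟨u, -, hb⟩
    rw [hun, hbody] at hb
    refine ⟨u.take (U w.length), List.length_take_le _ _, ?_⟩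
    rw [verdictBit_take]
    simpa using hb
  · rintro ⟨u, hu, hv⟩
    refine ⟨u, hu.trans (hU _), ?_⟩
    rw [hun, hbody, hv]

/-- **The running time of the simulation `N`** — hypothesis `hN` of
`MWSim.MurrayWilliams2018_lemma_4_1_ae_of_thm_3_1_of_thm_2_1_of_sim`, DISCHARGED: for all `γ`,
`K` and `F ∈ FP` there is an exponent `E ≥ 1` such that for every `Ref ∈ DTIME(nᴷ)`, every
constant `C_Nb`, every time-constructible monotone `t`, every time-constructible monotone `mv`
with `mv ≤ t + C₀`, and every verifier `V`, the simulation language `MWSim.simLang` (output length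
`C_Nb (ℓ + a + mv ℓ + 2)^{2K+2} + 7`, kept length `2 (c_V t N + c_V) + mv N + 2`) is in
`NTIME (t · ^ E)`. The verifier is the padded-body verifier of `PadVerif.exists_exponent_dom` for
the universal body `body γ K F` with the data prefix of the instance and the pad
`T_A(N) = A (t N + 1)^{k_A} + A`, `k_A = 2K + 2 + γ`, which exceeds every budget and size the body
needs (`body_eq_verdictBit`); `E = k_A · k`, `k` the exponent of the body (Murray–Williams, p. 14:
"In total, `N` takes time `O(… t(nᵢ)^{a+g} …)` … If we set `e ≥ a + g` …").
[cite: MurrayWilliams2018, Lemma 4.1 (proof)] -/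
theorem simLang_mem_NTIME (γ K : ℕ) (F : List Bool → List Bool) (hF : F ∈ FP) :
    ∃ E : ℕ, 1 ≤ E ∧ ∀ (Ref : Language Bool), Ref ∈ DTIME (fun n => n ^ K) → ∀ (CNb : ℕ) (t : ℕ → ℕ),
      IsTimeConstructible t → Monotone t → ∀ (mv : ℕ → ℕ), IsTimeConstructible mv → Monotone mv →
      ∀ C₀ : ℕ, (∀ n, mv n ≤ t n + C₀) → ∀ (L : Language Bool) (V : NVerifier t L),
        simLang t V Ref F γ mv (fun ℓ a => CNb * (ℓ + a + mv ℓ + 2) ^ (2 * K + 2) + 7)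
          (fun N => 2 * bound t V N + mv N + 2) ∈ NTIME (fun n => t n ^ E) := by
  obtain ⟨k, hk1, hdom⟩ := PadVerif.exists_exponent_dom (body_mem_FP γ K hF) (oneBit_body γ K F)
  set kA : ℕ := 2 * K + 2 + γ with hkA
  have hkA1 : 1 ≤ kA := by omega
  refine ⟨kA * k, Nat.one_le_iff_ne_zero.2 (Nat.mul_ne_zero (by omega) (by omega)),
    fun Ref hR CNb t ht htm mv hmv hmvm C₀ hC₀ L V => ?_⟩
  -- the machines
  have htc := ht
  obtain ⟨hge, ct, Mt, hMt⟩ := ht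
  obtain ⟨-, cm, Mm, hMm⟩ := hmv
  have hl : ∀ n, (unaryEncodeNat n).length = n := unary_decode_encode_nat
  have hMt' : ∀ n, Mt.OutputsWithin (unaryEncodeNat n) (encodeNat (t n)) (ct * t n + ct) := fun n => by
    have := hMt n; dsimp only at this; rwa [hl] at this
  have hMm' : ∀ n, Mm.OutputsWithin (unaryEncodeNat n) (encodeNat (mv n)) (cm * mv n + cm) := fun n => by
    have := hMm n; dsimp only at this; rwa [hl] at this
  simp only [DTIME, TimeClass, Set.mem_setOf_eq] at hR
  obtain ⟨cR, MR, hMR⟩ := hR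
  have hMR' : ∀ z : List Bool, MR.OutputsWithin z [Ref.boolIndicator z] (cR * z.length ^ K + cR) := fun z => hMR z
  -- the data and the pad
  set D : List Bool := dataOf (ClockedUS.ecode Mt) (ClockedUS.ecode Mm) (ClockedUS.ecode V.machine) (ClockedUS.ecode MR)
    (ones V.c) (ones CNb) with hD
  set aT : ℕ := FlatProg.haltAddr (ClockedUA.cM Mt) with haT
  set aM : ℕ := FlatProg.haltAddr (ClockedUA.cM Mm) with haM
  set aV : ℕ := FlatProg.haltAddr (ClockedUA.cM V.machine) with haV
  set aR : ℕ := FlatProg.haltAddr (ClockedUA.cM MR) with haR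
  set A : ℕ := (aT * (ct + ct) ^ 1 + 0) + (aM * (cm + (cm * C₀ + cm)) ^ 1 + 0) + (aV * (V.c + V.c) ^ 1 + 0) +
    (aR * cR * (15 + (3 * C₀ + 14)) ^ K + aR * cR) + (2 * (V.c + V.c) ^ 1 + 0) + (1 * (1 + C₀) ^ 1 + 0) +
    (CNb * (3 + (C₀ + 2)) ^ (2 * K + 2) + 7) + (1 * (2 * V.c + 2 * V.c) ^ γ + 0) +
    (1 * ((2 * V.c + 1) + (2 * V.c + C₀ + 2)) ^ 1 + 0) + 1 with hA
  have hA1 : 1 ≤ A := by simp only [hA]; omega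
  set TA : ℕ → ℕ := fun n => A * (1 * t n + 1) ^ kA + A with hTA
  have hTAtc : IsTimeConstructible TA := ((htc.mul_add le_rfl).pow hkA1).mul_add hA1
  have hTA1 : ∀ n, TA n = A * (t n + 1) ^ kA + A := fun n => by simp only [hTA, one_mul]
  -- every threshold is below the pad
  have hK1 : K ≤ kA := by omega
  have h1k : 1 ≤ kA := hkA1
  have hth : ∀ {f a b c d a' : ℕ} (n : ℕ), d ≤ kA → f ≤ a * (b * t n + c) ^ d + a' → a * (b + c) ^ d + a' ≤ A →
      f ≤ TA n := by
    intro f a b c d a' n hd hf hAi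
    rw [hTA1]
    exact (hf.trans (affine_pow_le a b c d a' kA hd (t n))).trans (Nat.add_le_add (Nat.mul_le_mul_right _ hAi) hAi)
  -- the body computes `verdictBit` on the pad `TA`
  have hbody : ∀ w u : List Bool, body γ K F (boolPair D (boolPair (boolPair w (ones (TA w.length))) u)) =
      [verdictBit t V Ref F γ mv (fun ℓ a => CNb * (ℓ + a + mv ℓ + 2) ^ (2 * K + 2) + 7)
        (fun N => 2 * bound t V N + mv N + 2) w u] := by
    intro w u
    have hmvN : mv w.length ≤ t w.length + C₀ := hC₀ _
    refine body_eq_verdictBit V Ref F γ K CNb C₀ htm hmvm hC₀ hge hMt' hMm' hMR' w u ?_ ?_ ?_ ?_ ?_ ?_ ?_ ?_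
    · exact hth w.length h1k (show aT * (ct * t w.length + ct) ≤ aT * (ct * t w.length + ct) ^ 1 + 0 by simp)
        (by simp only [hA]; omega)
    · refine hth w.length h1k (show aM * (cm * mv w.length + cm) ≤ aM * (cm * t w.length + (cm * C₀ + cm)) ^ 1 + 0 from ?_)
        (by simp only [hA]; omega)
      rw [pow_one, add_zero]
      refine Nat.mul_le_mul_left _ ?_
      have : cm * mv w.length ≤ cm * (t w.length + C₀) := Nat.mul_le_mul_left _ hmvN
      nlinarith
    · exact hth w.length h1k (show aV * (V.c * t w.length + V.c) ≤ aV * (V.c * t w.length + V.c) ^ 1 + 0 by simp)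
        (by simp only [hA]; omega)
    · refine hth w.length hK1 (show aR * (cR * (15 * t w.length + 3 * C₀ + 14) ^ K + cR) ≤
          (aR * cR) * (15 * t w.length + (3 * C₀ + 14)) ^ K + aR * cR from ?_) (by simp only [hA]; omega)
      rw [Nat.mul_add, ← Nat.mul_assoc, Nat.add_assoc]
    · exact hth w.length h1k (show 2 * (V.c * t w.length + V.c) ≤ 2 * (V.c * t w.length + V.c) ^ 1 + 0 by simp)
        (by simp only [hA]; omega)
    · exact hth w.length h1k (show t w.length + C₀ ≤ 1 * (1 * t w.length + C₀) ^ 1 + 0 by simp)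
        (by simp only [hA]; omega)
    · exact hth w.length (le_of_eq rfl |>.trans (by omega : 2 * K + 2 ≤ kA))
        (show CNb * (3 * t w.length + C₀ + 2) ^ (2 * K + 2) + 7 ≤ CNb * (3 * t w.length + (C₀ + 2)) ^ (2 * K + 2) + 7 by
          rw [Nat.add_assoc])
        (by simp only [hA]; omega)
    · exact hth w.length (by omega : γ ≤ kA)
        (show (2 * (V.c * t w.length + V.c)) ^ γ ≤ 1 * (2 * V.c * t w.length + 2 * V.c) ^ γ + 0 by
          rw [one_mul, add_zero, Nat.mul_add, Nat.mul_assoc])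
        (by simp only [hA]; omega)
  -- the kept length is below the pad
  have hU : ∀ N, 2 * bound t V N + mv N + 2 ≤ 2 * N + TA N + 2 := by
    intro N
    have h1 : 2 * bound t V N + mv N + 2 ≤ TA N := by
      refine hth N h1k (show 2 * bound t V N + mv N + 2 ≤ 1 * ((2 * V.c + 1) * t N + (2 * V.c + C₀ + 2)) ^ 1 + 0 from ?_)
        (by simp only [hA]; omega)
      simp only [bound, pow_one, one_mul, add_zero]
      have := hC₀ N
      nlinarith
    omega
  -- the language and its time
  have hlang := lang_body_eq_simLang (mv := mv) V Ref F γ K (fun ℓ a => CNb * (ℓ + a + mv ℓ + 2) ^ (2 * K + 2) + 7)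
    (fun N => 2 * bound t V N + mv N + 2) TA D hU hbody
  rw [← hlang]
  refine hdom D TA hTAtc (fun n => t n ^ (kA * k)) ((2 * A) ^ k * 2 ^ (kA * k)) fun n => ?_
  -- `(TA n)^k ≤ (2A)^k 2^{kA k} (t n)^{kA k} + (2A)^k 2^{kA k}`
  rw [hTA1]
  have h1 : A * (t n + 1) ^ kA + A ≤ 2 * A * (t n + 1) ^ kA := by
    have : 1 ≤ (t n + 1) ^ kA := Nat.one_le_pow _ _ (Nat.succ_pos _)
    nlinarith
  have h2 : (A * (t n + 1) ^ kA + A) ^ k ≤ (2 * A) ^ k * (t n + 1) ^ (kA * k) := by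
    calc (A * (t n + 1) ^ kA + A) ^ k ≤ (2 * A * (t n + 1) ^ kA) ^ k := Nat.pow_le_pow_left h1 _
      _ = (2 * A) ^ k * (t n + 1) ^ (kA * k) := by rw [mul_pow, ← pow_mul]
  have h3 : (t n + 1) ^ (kA * k) ≤ 2 ^ (kA * k) * t n ^ (kA * k) + 1 := succ_pow_le _ _
  have h4 : 1 ≤ 2 ^ (kA * k) := Nat.one_le_two_pow
  calc (A * (t n + 1) ^ kA + A) ^ k ≤ (2 * A) ^ k * (t n + 1) ^ (kA * k) := h2
    _ ≤ (2 * A) ^ k * (2 ^ (kA * k) * t n ^ (kA * k) + 1) := Nat.mul_le_mul_left _ h3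
    _ = (2 * A) ^ k * 2 ^ (kA * k) * t n ^ (kA * k) + (2 * A) ^ k := by ring
    _ ≤ (2 * A) ^ k * 2 ^ (kA * k) * t n ^ (kA * k) + (2 * A) ^ k * 2 ^ (kA * k) :=
        Nat.add_le_add_left (Nat.le_mul_of_pos_right _ (by omega)) _

end NTIME

/-! ### Lemma 4.1 (a.e. form) from Thm. 3.1 and Thm. 2.1 alone -/

/-- **Murray–Williams 2018, Lemma 4.1 (almost-everywhere form) from its two quoted ingredients.**
The conditional assembly `MWSim.MurrayWilliams2018_lemma_4_1_ae_of_thm_3_1_of_thm_2_1_of_sim`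
(`MurrayWilliams2018Lemma41Assembly.lean`) with its third hypothesis — the running time of the
simulation `N` — discharged by `simLang_mem_NTIME`: the named fact
`MurrayWilliams2018_lemma_4_1_ae` follows from `h31` (Thm. 3.1 of the source over the tree, with a
referee of universal exponent `K`) and `h21` (Thm. 2.1 = Umans 2003, Thm. 6, over
`tableGenerator`/`IsSizePseudorandom`) alone. [cite: MurrayWilliams2018, Lemma 4.1] -/
theorem MurrayWilliams2018_lemma_4_1_ae_of_thm_3_1_of_thm_2_1
    (h31 : ∃ d₁ d₂ d₃ K : ℕ, 1 ≤ d₁ ∧ 1 ≤ d₂ ∧ 1 ≤ d₃ ∧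
      ∀ (σ σ₁ σ₂ : ℕ → ℕ), StrictMono σ → IsTimeConstructible σ →
        (∀ᶠ n in atTop, 2 * n * σ n < 2 ^ n) → IsTimeConstructible σ₁ → IsTimeConstructible σ₂ →
        (∀ n, σ n ^ (2 * d₂) ≤ σ₂ n) → (∀ n, σ (σ₂ n) ≤ σ₁ n) → (∀ n, σ n ^ (2 * d₁ + 1) ≤ σ₁ n) →
        ∃ (L₁ Ref : Language Bool) (adv : ℕ → List Bool), Ref ∈ DTIME (fun n => n ^ K) ∧
          (∀ n, (adv n).length ≤ 2 * Nat.log 2 (σ₂ n) + 2) ∧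
          (∀ x : List Bool,
            (x ∈ L₁ → ∃ z : List Bool, z.length = σ₁ x.length ^ 2 * σ₂ x.length ^ d₃ ∧
              (2 / 3 : ℝ) ≤ uniformProb (σ₁ x.length ^ 2 * σ₂ x.length ^ d₃)
                {r | boolPair (boolPair (boolPair x (adv x.length)) z) r ∈ Ref}) ∧
            (x ∉ L₁ → ∀ z : List Bool, z.length = σ₁ x.length ^ 2 * σ₂ x.length ^ d₃ →
              uniformProb (σ₁ x.length ^ 2 * σ₂ x.length ^ d₃)
                {r | boolPair (boolPair (boolPair x (adv x.length)) z) r ∈ Ref} ≤ 1 / 3)) ∧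
          ∀ᶠ n in atTop, σ n < L₁.circuitSize n ∨ σ (σ₂ n) < L₁.circuitSize (σ₂ n))
    (h21 : ∃ g : ℕ, 1 ≤ g ∧ ∃ F : List Bool → List Bool, F ∈ FP ∧
      ∀ (m u : ℕ) (f : (Fin m → Bool) → Bool), 1 ≤ u → u ^ g ≤ circuitSizeOver B2 f →
        IsSizePseudorandom (tableGenerator F f (g * m) u)) :
    MurrayWilliams2018_lemma_4_1_ae :=
  MurrayWilliams2018_lemma_4_1_ae_of_thm_3_1_of_thm_2_1_of_sim h31 h21
    fun γ K F hF => simLang_mem_NTIME γ K F hF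

end Mach

end MWSim

end Literature.Computability.Complexity

end
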